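import Mathlib
import HarnessLib
import Summits.ResolutionOfSingularities.ResolutionOfSingularities.Theorems.HomologicalConductorSurfaceTerminationAntinefLattice

/-!
# Kill test `SurfaceTermination` (stmt-ResolutionOfSingularities-16488) — the SUPPORT of an anti-nef cycle:
# «a non-zero anti-nef cycle on a connected exceptional configuration is `≥ E`»

Route `ResolutionOfSingularities/HomologicalConductor`, crux chain W4.4 (lead g25; KERNEL-g25 §2, the eternal-thread
anatomy: full support of `Z_K`, of the `p_g`-cycle `Z_m` and of the cohomological cycle).  `[OURS]` — AI-formalised, weaker
than expert review; NOT a statement of the manuscript under review (Hironaka 2017); ℤ-valued lattice data only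
(`Q : Matrix (Fin n) (Fin n) ℤ` = the intersection form of an exceptional configuration `E₁,…,E_n`, `Z : Fin n → ℤ` = a cycle,
«anti-nef» = `∀ i, (Q Z)_i = Z·E_i ≤ 0`); builds on p731075 (`…SurfaceTerminationAntinefLattice`, `nonneg_of_antinef`).

* `eq_zero_of_antinef_of_apply_eq_zero` — the support of an anti-nef cycle is closed under adjacency: if `Z` is anti-nef
  (off-diagonal entries `≥ 0`, `Z ≥ 0`), `Z_i = 0` and `Q_{ij} > 0`, then `Z_j = 0` (the row `(QZ)_i = Σ_{j ≠ i} Q_{ij} Z_j ≤ 0`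
  is a sum of non-negative terms).
* `pos_of_antinef_of_connected` — on a negative-definite form with non-negative off-diagonal entries and CONNECTED dual graph,
  a non-zero anti-nef cycle has ALL coefficients `≥ 1` («`Z ≠ 0` anti-nef ⇒ `Z ≥ E`», Artin 1966 / Okuma–Watanabe–Yoshida,
  *Good ideals and `p_g`-ideals*, §2.1).
* `antinef_eq_zero_or_forall_pos` — the dichotomy form.
-/

-- single-problem summit: the doubled namespace component is forced
set_option linter.dupNamespace false

namespace Summit.ResolutionOfSingularities.ResolutionOfSingularities.Theorems.NoZeno.AntinefSupport

open Matrix Finset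
open Summit.ResolutionOfSingularities.ResolutionOfSingularities.Theorems.NoZeno.AntinefLattice

/-- **The support of an effective anti-nef cycle is closed under adjacency.**  If the off-diagonal entries of `Q` are
non-negative, `Z ≥ 0`, `(Q Z)_i ≤ 0`, `Z_i = 0` and `Q_{ij} > 0`, then `Z_j = 0` (for `j = i` trivially; for `j ≠ i` the
`i`-th row `(Q Z)_i = Σ_{l ≠ i} Q_{il} Z_l` is a sum of non-negative terms bounded above by `0`).
[folklore; Artin 1966, OWY 2016 §2.1] -/
theorem eq_zero_of_antinef_of_apply_eq_zero {n : ℕ} (Q : Matrix (Fin n) (Fin n) ℤ)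
    (hoff : ∀ i j, i ≠ j → 0 ≤ Q i j) (Z : Fin n → ℤ) (hZ : ∀ l, 0 ≤ Z l)
    {i j : Fin n} (hanti : (Q *ᵥ Z) i ≤ 0) (hi : Z i = 0) (hQ : 0 < Q i j) :
    Z j = 0 := by
  -- every term of the row sum is non-negative
  have hterm : ∀ l ∈ (univ : Finset (Fin n)), 0 ≤ Q i l * Z l := by
    intro l _
    by_cases hl : i = l
    · subst hl
      rw [hi, mul_zero]
    · exact mul_nonneg (hoff i l hl) (hZ l)
  -- hence the `j`-th term is bounded by the row sum `≤ 0`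
  have hle : Q i j * Z j ≤ (Q *ᵥ Z) i := by
    simpa [Matrix.mulVec, dotProduct] using Finset.single_le_sum hterm (Finset.mem_univ j)
  have hjle : Q i j * Z j ≤ 0 := hle.trans hanti
  rcases (hZ j).lt_or_eq with hpos | hzero
  · exact absurd hjle (not_le.mpr (mul_pos hQ hpos))
  · exact hzero.symm

/-- **A non-zero anti-nef cycle on a connected configuration is `≥ E`.**  Let `Q` be negative definite with non-negative
off-diagonal entries and CONNECTED dual graph (every proper non-empty index set `S` has some `i ∈ S`, `j ∉ S` with
`Q_{ij} ≠ 0`).  If `Z ≠ 0` is anti-nef then every coefficient of `Z` is positive.  Proof: `Z ≥ 0` (`nonneg_of_antinef`,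
p731075); the zero set `S = {i : Z_i = 0}` is closed under adjacency by `eq_zero_of_antinef_of_apply_eq_zero`, so by
connectedness it is empty or everything, and it is not everything. [Artin 1966; OWY 2016 §2.1 «if a cycle `Z ≠ 0` is
anti-nef, then `Z ≥ E`»] -/
theorem pos_of_antinef_of_connected {n : ℕ} (Q : Matrix (Fin n) (Fin n) ℤ)
    (hneg : (-(Q.map (Int.cast : ℤ → ℚ))).PosDef) (hoff : ∀ i j, i ≠ j → 0 ≤ Q i j)
    (hconn : ∀ S : Finset (Fin n), S.Nonempty → S ≠ univ → ∃ i ∈ S, ∃ j ∉ S, Q i j ≠ 0)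
    (Z : Fin n → ℤ) (hZ0 : Z ≠ 0) (hanti : ∀ i, (Q *ᵥ Z) i ≤ 0) : ∀ i, 0 < Z i := by
  classical
  have hnn : ∀ l, 0 ≤ Z l := fun l => nonneg_of_antinef Q hneg hoff Z hanti l
  -- the zero set of `Z`
  set S : Finset (Fin n) := univ.filter fun i => Z i = 0 with hS
  by_contra hcon
  push Not at hcon
  obtain ⟨i₀, hi₀⟩ := hcon
  have hi₀0 : Z i₀ = 0 := le_antisymm hi₀ (hnn i₀)
  have hSne : S.Nonempty := ⟨i₀, by simp [hS, hi₀0]⟩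
  have hSuniv : S ≠ univ := by
    intro h
    apply hZ0
    funext l
    have hl : l ∈ S := by rw [h]; exact mem_univ l
    simpa [hS] using hl
  obtain ⟨i, hi, j, hj, hQ⟩ := hconn S hSne hSuniv
  have hiz : Z i = 0 := by simpa [hS] using hi
  have hjz : Z j ≠ 0 := by simpa [hS] using hj
  have hij : i ≠ j := by
    rintro rfl
    exact hjz hiz
  have hQpos : 0 < Q i j := lt_of_le_of_ne (hoff i j hij) (Ne.symm hQ)
  exact hjz (eq_zero_of_antinef_of_apply_eq_zero Q hoff Z hnn (hanti i) hiz hQpos)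

/-- **Dichotomy form**: on a connected negative-definite configuration with non-negative off-diagonal entries an anti-nef
cycle is either `0` or has full support with all coefficients `≥ 1`. [Artin 1966; OWY 2016 §2.1] -/
theorem antinef_eq_zero_or_forall_pos {n : ℕ} (Q : Matrix (Fin n) (Fin n) ℤ)
    (hneg : (-(Q.map (Int.cast : ℤ → ℚ))).PosDef) (hoff : ∀ i j, i ≠ j → 0 ≤ Q i j)
    (hconn : ∀ S : Finset (Fin n), S.Nonempty → S ≠ univ → ∃ i ∈ S, ∃ j ∉ S, Q i j ≠ 0)
    (Z : Fin n → ℤ) (hanti : ∀ i, (Q *ᵥ Z) i ≤ 0) : Z = 0 ∨ ∀ i, 1 ≤ Z i := by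
  by_cases hZ0 : Z = 0
  · exact Or.inl hZ0
  · exact Or.inr fun i => pos_of_antinef_of_connected Q hneg hoff hconn Z hZ0 hanti i

/-- **Sub-configurations orthogonal to a non-zero anti-nef cycle are proper.**  On a connected negative-definite
configuration with non-negative off-diagonal entries, if `Z ≠ 0` is anti-nef then some curve has `Z·E_j < 0`; combined
with `pos_of_antinef_of_connected` this is the shape used for `NBl_{I_Z}`: the contracted set `{j : Z·E_j = 0}` is a proper
sub-configuration and `Z` itself has full support. [this work; restates p731075 `exists_mulVec_neg_of_ne_zero` next to the
support statement] -/
theorem exists_mulVec_neg_and_forall_pos {n : ℕ} (Q : Matrix (Fin n) (Fin n) ℤ)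
    (hneg : (-(Q.map (Int.cast : ℤ → ℚ))).PosDef) (hoff : ∀ i j, i ≠ j → 0 ≤ Q i j)
    (hconn : ∀ S : Finset (Fin n), S.Nonempty → S ≠ univ → ∃ i ∈ S, ∃ j ∉ S, Q i j ≠ 0)
    (Z : Fin n → ℤ) (hZ0 : Z ≠ 0) (hanti : ∀ i, (Q *ᵥ Z) i ≤ 0) :
    (∃ j, (Q *ᵥ Z) j < 0) ∧ ∀ i, 0 < Z i :=
  ⟨exists_mulVec_neg_of_ne_zero Q hneg Z hZ0 hanti, pos_of_antinef_of_connected Q hneg hoff hconn Z hZ0 hanti⟩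

end Summit.ResolutionOfSingularities.ResolutionOfSingularities.Theorems.NoZeno.AntinefSupport
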